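import Literature.GroupTheory.TwoSheetAnnihilator
import Mathlib.LinearAlgebra.Dual.Lemmas
import HarnessLib

/-!
# The two-sheet DEGENERACY lemma: a singular odd Fourier block yields a non-zero rational annihilator

COR-CM (cell `pub-hodgecm2`), binder seat b04 (gen 28), count-neutral claim CYCLIC-SEMIDIRECT-EIGHT-DEGENERATE, part I — the
CONVERSE of gen 20's two-sheet annihilator lemma `CorCM/TwoSheetAnnihilator` (`TwoSheet.eq_zero_of_twoSheet`).  Pure finite-group
harmonic analysis plus one line of linear algebra (Mathlib only): theorems, no definition, no named fact, no `sorry`.  `HC_CM` is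
neither used nor claimed.

SETTING (as in part II of gen 20).  `G ⊇ i(A)` with `A` finite ABELIAN of index two, `G = i(A) ⊔ i(A) x`, `x i(u) x⁻¹ = i(θ u)`,
`x² = i(q)`, an involution `c ∈ A` fixed by `θ`; a finite `S ⊆ G` with SHEETS `S₁ = i⁻¹ S`, `S₂ = {u | i(u) x ∈ S}`; for a character
`χ` of `A` the two-sheet determinant `Δ(χ) = Ŝ₁(χ) Ŝ₁(χ∘θ) − χ(q) Ŝ₂(χ) Ŝ₂(χ∘θ)`, `Ŝ(χ) = Σ_{s∈S} χ(s)`.  Gen 20 proved: if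
`Δ(χ) ≠ 0` for every ODD `χ` (`χ(c) = −1`), every `i(c)`-antisymmetric rational weight annihilated by the right translates of `S`
vanishes (so a CM type read as `S` is NONDEGENERATE, by the annihilator criterion `GaloisRank.isNondegenerate_iff_forall_annihilator`).
HERE: if `Δ(χ) = 0` for SOME odd `χ`, there IS a non-zero `i(c)`-antisymmetric weight `b : G → ℚ` with `Σ_{s∈S} b(s g) = 0` for
all `g` — so the CM type is DEGENERATE.  Together: **nondegenerate ⟺ no odd character has a singular two-sheet block** (Kubota's
Lemma 2 for groups with an abelian subgroup of index two).

PROOF.  At a singular `χ` the `2 × 2` system `a Ŝ₁(χ) + b Ŝ₂(χθ) = 0`, `a χ(q) Ŝ₂(χ) + b Ŝ₁(χθ) = 0` has a non-zero solution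
`(a, b)` (`exists_kernel_of_det_eq_zero`); the PURE MODES `α = a·χ`, `β = b·(χ∘θ)` then solve the two-sheet system
(`twoSheet_modes`), i.e. the complex weight `b_ℂ(i u) = a χ(u)`, `b_ℂ(i(u) x) = b χ(θ u)` is antisymmetric, annihilated and non-zero
(`exists_complex_annihilator_of_det_eq_zero`); composing with a `ℚ`-linear functional `ℂ → ℚ` that does not kill a non-zero value
(`Module.Projective.exists_dual_ne_zero`: `ℂ` is a free `ℚ`-module) gives the RATIONAL weight (`exists_rat_annihilator_of_complex`,
`exists_annihilator_of_det_eq_zero`).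

* §1 `exists_kernel_of_det_eq_zero`, `twoSheet_modes`.
* §2 `exists_rat_annihilator_of_complex` — descent `ℂ → ℚ` of a non-zero antisymmetric annihilated weight (any group).
* §3 **`exists_annihilator_of_det_eq_zero`** — GROUP FORM, hypotheses shaped exactly as in `TwoSheet.eq_zero_of_twoSheet`.

## References

* [Kubota1965] T. Kubota, *On the field extension by complex multiplication*, Trans. AMS 118 (1965), §4 Lemma 2.
* [Dodson1987] B. Dodson, J. Algebra 111 (1987), §1.1 p. 50 (the rank via translates).
* [Gordon1999HodgeAVSurvey] B. B. Gordon, *A survey of the Hodge conjecture for abelian varieties*, Prop. 9.4.1, §9.4.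

Provenance: Literature home (namespace `Literature.GroupTheory.TwoSheet`) of the Summits-side `CorCM/TwoSheetDegenerate` (cell `pub-hodgecm2`, COR-CM; all its imports are `Literature/`, Mathlib and the already re-homed `TwoSheetAnnihilator`), which `Literature/` may not import; theorems only, no named fact, no definition. Nothing here bears on `HC_CM`. Lane `lit-hodgefound` (Layer A3: CM types, their Kubota ranks and Galois combinatorics), seat p20.
-/

noncomputable section

open scoped BigOperators

namespace Literature.GroupTheory.TwoSheet

open AddChar

variable {A : Type*} [CommGroup A] [Fintype A] [DecidableEq A]

/-! ## §1 A singular `2 × 2` block and its pure modes -/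

omit [Fintype A] [DecidableEq A] in
/-- A singular `2 × 2` complex matrix `(m₁₁ m₁₂ ; m₂₁ m₂₂)` has a non-zero row kernel vector `(a, b)`:
`a m₁₁ + b m₁₂ = 0`, `a m₂₁ + b m₂₂ = 0`. [cite: Kubota1965, §4 Lemma 2] -/
theorem exists_kernel_of_det_eq_zero (m₁₁ m₁₂ m₂₁ m₂₂ : ℂ) (hdet : m₁₁ * m₂₂ - m₁₂ * m₂₁ = 0) :
    ∃ a b : ℂ, (a ≠ 0 ∨ b ≠ 0) ∧ a * m₁₁ + b * m₂₁ = 0 ∧ a * m₁₂ + b * m₂₂ = 0 := by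
  by_cases h : m₂₂ ≠ 0 ∨ m₁₂ ≠ 0
  · refine ⟨m₂₂, -m₁₂, ?_, by linear_combination hdet, by ring⟩
    rcases h with h | h
    · exact Or.inl h
    · exact Or.inr (neg_ne_zero.2 h)
  · push Not at h
    obtain ⟨h22, h12⟩ := h
    by_cases h' : m₂₁ ≠ 0 ∨ m₁₁ ≠ 0
    · refine ⟨m₂₁, -m₁₁, ?_, by ring, by rw [h22, h12]; ring⟩
      rcases h' with h' | h'
      · exact Or.inl h'
      · exact Or.inr (neg_ne_zero.2 h')
    · push Not at h'
      exact ⟨1, 0, Or.inl one_ne_zero, by rw [h'.2]; ring, by rw [h12]; ring⟩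

omit [Fintype A] [DecidableEq A] in
/-- **Pure modes solve the two-sheet system.**  If `(a, b)` solves the Fourier system at `χ` —
`a Ŝ₁(χ) + b Ŝ₂(χ∘θ) = 0` and `a χ(q) Ŝ₂(χ) + b Ŝ₁(χ∘θ) = 0` — then `α = a·χ`, `β = b·(χ∘θ)` satisfy
`Σ_{s∈S₁} α(s u) + Σ_{t∈S₂} β(t θ(u)) = 0` and `Σ_{s∈S₁} β(s θ(u)) + Σ_{t∈S₂} α(t q u) = 0` for every `u`.
[cite: Kubota1965, §4 Lemma 2] -/
theorem twoSheet_modes {q : A} (θ : A ≃* A) (hθθ : ∀ u, θ (θ u) = u) (S₁ S₂ : Finset A)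
    (χ : AddChar (Additive A) ℂ) (a b : ℂ)
    (E1 : a * (∑ s ∈ S₁, χ (Additive.ofMul s)) + b * (∑ t ∈ S₂, χ (Additive.ofMul (θ t))) = 0)
    (E2 : a * (χ (Additive.ofMul q) * ∑ t ∈ S₂, χ (Additive.ofMul t)) +
      b * (∑ s ∈ S₁, χ (Additive.ofMul (θ s))) = 0) :
    (∀ u, ∑ s ∈ S₁, a * χ (Additive.ofMul (s * u)) + ∑ t ∈ S₂, b * χ (Additive.ofMul (θ (t * θ u))) = 0) ∧
    (∀ u, ∑ s ∈ S₁, b * χ (Additive.ofMul (θ (s * θ u))) +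
      ∑ t ∈ S₂, a * χ (Additive.ofMul (t * (q * u))) = 0) := by
  constructor
  · intro u
    have h1 : ∑ s ∈ S₁, a * χ (Additive.ofMul (s * u)) =
        χ (Additive.ofMul u) * (a * ∑ s ∈ S₁, χ (Additive.ofMul s)) := by
      rw [Finset.mul_sum, Finset.mul_sum]
      refine Finset.sum_congr rfl fun s _ => ?_
      rw [ofMul_mul, map_add_eq_mul]; ring
    have h2 : ∑ t ∈ S₂, b * χ (Additive.ofMul (θ (t * θ u))) =
        χ (Additive.ofMul u) * (b * ∑ t ∈ S₂, χ (Additive.ofMul (θ t))) := by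
      rw [Finset.mul_sum, Finset.mul_sum]
      refine Finset.sum_congr rfl fun t _ => ?_
      rw [map_mul, hθθ, ofMul_mul, map_add_eq_mul]; ring
    rw [h1, h2, ← mul_add, E1, mul_zero]
  · intro u
    have h1 : ∑ s ∈ S₁, b * χ (Additive.ofMul (θ (s * θ u))) =
        χ (Additive.ofMul u) * (b * ∑ s ∈ S₁, χ (Additive.ofMul (θ s))) := by
      rw [Finset.mul_sum, Finset.mul_sum]
      refine Finset.sum_congr rfl fun s _ => ?_
      rw [map_mul, hθθ, ofMul_mul, map_add_eq_mul]; ring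
    have h2 : ∑ t ∈ S₂, a * χ (Additive.ofMul (t * (q * u))) =
        χ (Additive.ofMul u) * (a * (χ (Additive.ofMul q) * ∑ t ∈ S₂, χ (Additive.ofMul t))) := by
      rw [Finset.mul_sum, Finset.mul_sum, Finset.mul_sum]
      refine Finset.sum_congr rfl fun t _ => ?_
      rw [ofMul_mul, ofMul_mul, map_add_eq_mul, map_add_eq_mul]; ring
    rw [h1, h2, ← mul_add, add_comm, E2, mul_zero]

/-! ## §2 Descent of an annihilator from `ℂ` to `ℚ` -/

/-- **A non-zero complex antisymmetric annihilated weight yields a rational one**: compose with a `ℚ`-linear functional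
`ℂ → ℚ` not vanishing at one non-zero value (`ℂ` is a free, hence projective, `ℚ`-module). [cite: Kubota1965, §4 Lemma 2] -/
theorem exists_rat_annihilator_of_complex {G : Type*} [Group G] (S : Finset G) (c : G) (bC : G → ℂ) (g₀ : G)
    (h0 : bC g₀ ≠ 0) (hanti : ∀ g, bC (c * g) = -bC g) (hann : ∀ g, ∑ s ∈ S, bC (s * g) = 0) :
    ∃ b : G → ℚ, b g₀ ≠ 0 ∧ (∀ g, b (c * g) = -b g) ∧ ∀ g, ∑ s ∈ S, b (s * g) = 0 := by
  obtain ⟨f, hf⟩ := Module.Projective.exists_dual_ne_zero ℚ h0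
  refine ⟨fun g => f (bC g), hf, fun g => ?_, fun g => ?_⟩
  · show f (bC (c * g)) = -f (bC g)
    rw [hanti, map_neg]
  · show ∑ s ∈ S, f (bC (s * g)) = 0
    rw [← map_sum, hann, map_zero]

/-! ## §3 Group form: a singular odd block gives a non-zero rational annihilator -/

section Group

variable {G : Type*} [Group G] [Fintype G] [DecidableEq G]

omit [DecidableEq A] [DecidableEq G] in
/-- **The complex annihilator of a singular odd block.**  In the setting of `TwoSheet.eq_zero_of_twoSheet`, if the odd
character `χ` (`χ(c) = −1`) has `Δ(χ) = Ŝ₁(χ)Ŝ₁(χθ) − χ(q)Ŝ₂(χ)Ŝ₂(χθ) = 0`, then for a non-zero solution `(a, b)` of its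
`2 × 2` system the weight `b_ℂ(i u) = a χ(u)`, `b_ℂ(i(u) x) = b χ(θ u)` is `i(c)`-antisymmetric, annihilated by every right
translate of `S`, and non-zero. [cite: Kubota1965, §4 Lemma 2] [cite: Dodson1987, §1.1 (p. 50)] -/
theorem exists_complex_annihilator_of_det_eq_zero (i : A →* G) (hi : Function.Injective i) (x : G)
    (hx : ∀ u, i u ≠ x) (hcov : ∀ g : G, (∃ u, g = i u) ∨ (∃ u, g = i u * x)) (θ : A ≃* A)
    (hθ : ∀ u, x * i u = i (θ u) * x) (q : A) (hq : x * x = i q) {c : A} (hθc : θ c = c)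
    (S : Finset G) (S₁ S₂ : Finset A) (hS₁ : ∀ u, u ∈ S₁ ↔ i u ∈ S) (hS₂ : ∀ u, u ∈ S₂ ↔ i u * x ∈ S)
    (χ : AddChar (Additive A) ℂ) (hχ : χ (Additive.ofMul c) = -1)
    (hΔ : (∑ s ∈ S₁, χ (Additive.ofMul s)) * (∑ s ∈ S₁, χ (Additive.ofMul (θ s))) -
        χ (Additive.ofMul q) * ((∑ t ∈ S₂, χ (Additive.ofMul t)) * (∑ t ∈ S₂, χ (Additive.ofMul (θ t)))) = 0) :
    ∃ (bC : G → ℂ) (g₀ : G), bC g₀ ≠ 0 ∧ (∀ g, bC (i c * g) = -bC g) ∧ ∀ g : G, ∑ s ∈ S, bC (s * g) = 0 := by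
  classical
  have hθθ := twist_twist i hi x θ hθ q hq
  obtain ⟨a, b, hab, E1, E2⟩ := exists_kernel_of_det_eq_zero (∑ s ∈ S₁, χ (Additive.ofMul s))
    (χ (Additive.ofMul q) * ∑ t ∈ S₂, χ (Additive.ofMul t)) (∑ t ∈ S₂, χ (Additive.ofMul (θ t)))
    (∑ s ∈ S₁, χ (Additive.ofMul (θ s))) (by linear_combination hΔ)
  obtain ⟨h1, h2⟩ := twoSheet_modes θ hθθ S₁ S₂ χ a b E1 E2
  -- the decomposition `G = i(A) ⊔ i(A) x` as a definition by cases
  have hdec : ∀ g : G, ¬ (∃ u, g = i u) → ∃ u, g = i u * x := fun g h => (hcov g).resolve_left h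
  let bC : G → ℂ := fun g =>
    if h : ∃ u, g = i u then a * χ (Additive.ofMul h.choose) else b * χ (Additive.ofMul (θ (hdec g h).choose))
  have hnot : ∀ u, ¬ ∃ u', i u * x = i u' := fun u ⟨u', hu'⟩ =>
    hx (u⁻¹ * u') (by rw [map_mul, map_inv, ← hu', inv_mul_cancel_left])
  have hbC1 : ∀ u, bC (i u) = a * χ (Additive.ofMul u) := fun u => by
    have h : ∃ u', i u = i u' := ⟨u, rfl⟩
    simp only [bC, dif_pos h]
    rw [← hi h.choose_spec]
  have hbC2 : ∀ u, bC (i u * x) = b * χ (Additive.ofMul (θ u)) := fun u => by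
    simp only [bC, dif_neg (hnot u)]
    rw [← hi (mul_right_cancel (hdec _ (hnot u)).choose_spec)]
  refine ⟨bC, if a ≠ 0 then i 1 else i 1 * x, ?_, ?_, ?_⟩
  · -- non-zero: `b_ℂ(i 1) = a`, `b_ℂ(i(1) x) = b`
    split_ifs with ha
    · rwa [hbC1, ofMul_one, map_zero_eq_one, mul_one]
    · push Not at ha
      rw [hbC2, map_one, ofMul_one, map_zero_eq_one, mul_one]
      exact hab.resolve_left (not_not.2 ha)
  · -- antisymmetric
    intro g
    rcases hcov g with ⟨w, rfl⟩ | ⟨w, rfl⟩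
    · rw [← map_mul, hbC1, hbC1, ofMul_mul, map_add_eq_mul, hχ]; ring
    · rw [← mul_assoc, ← map_mul, hbC2, hbC2, map_mul, hθc, ofMul_mul, map_add_eq_mul, hχ]; ring
  · -- annihilated
    intro g
    rw [sum_eq_sum_sheets i hi x hx hcov S S₁ S₂ hS₁ hS₂ (fun s => bC (s * g))]
    rcases hcov g with ⟨w, rfl⟩ | ⟨w, rfl⟩
    · have e1 : ∀ u, i u * i w = i (u * w) := fun u => by rw [map_mul]
      have e2 : ∀ u, i u * x * i w = i (u * θ w) * x := fun u => by rw [mul_assoc, hθ, map_mul, mul_assoc]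
      simp only [e1, e2, hbC1, hbC2]
      exact h1 w
    · have e1 : ∀ u, i u * (i w * x) = i (u * w) * x := fun u => by rw [map_mul, mul_assoc]
      have e2 : ∀ u, i u * x * (i w * x) = i (u * (q * θ w)) := fun u => by
        calc i u * x * (i w * x) = i u * (x * i w) * x := by simp only [mul_assoc]
          _ = i u * (i (θ w) * x) * x := by rw [hθ]
          _ = i u * (i (θ w) * (x * x)) := by simp only [mul_assoc]
          _ = i (u * (q * θ w)) := by rw [hq, ← map_mul i (θ w) q, ← map_mul, mul_comm (θ w) q]
      simp only [e1, e2, hbC1, hbC2]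
      have h := h2 (θ w)
      simp only [hθθ] at h
      exact h

omit [DecidableEq A] [DecidableEq G] in
/-- **THE TWO-SHEET DEGENERACY THEOREM (group form).**  `i : A →* G` injective from a finite abelian group with image of
index two (`G = i(A) ⊔ i(A) x`), `x i(u) = i(θ u) x`, `x² = i(q)`, `c ∈ A` with `θ c = c`; `S ⊆ G` with sheets `S₁ = {u | i u ∈ S}`,
`S₂ = {u | i(u) x ∈ S}`.  If SOME odd character `χ` of `A` (`χ(c) = −1`) has `Ŝ₁(χ)Ŝ₁(χθ) − χ(q)Ŝ₂(χ)Ŝ₂(χθ) = 0`, then there is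
a NON-ZERO `i(c)`-antisymmetric `b : G → ℚ` annihilated by all right translates of `S` (`Σ_{s∈S} b(s g) = 0`) — the converse of
`TwoSheet.eq_zero_of_twoSheet`; with `GaloisRank.isNondegenerate_iff_forall_annihilator` a CM type read as `S` is DEGENERATE.
[cite: Kubota1965, §4 Lemma 2] [cite: Dodson1987, §1.1 (p. 50)] -/
theorem exists_annihilator_of_det_eq_zero (i : A →* G) (hi : Function.Injective i) (x : G) (hx : ∀ u, i u ≠ x)
    (hcov : ∀ g : G, (∃ u, g = i u) ∨ (∃ u, g = i u * x)) (θ : A ≃* A) (hθ : ∀ u, x * i u = i (θ u) * x)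
    (q : A) (hq : x * x = i q) {c : A} (hθc : θ c = c)
    (S : Finset G) (S₁ S₂ : Finset A) (hS₁ : ∀ u, u ∈ S₁ ↔ i u ∈ S) (hS₂ : ∀ u, u ∈ S₂ ↔ i u * x ∈ S)
    (χ : AddChar (Additive A) ℂ) (hχ : χ (Additive.ofMul c) = -1)
    (hΔ : (∑ s ∈ S₁, χ (Additive.ofMul s)) * (∑ s ∈ S₁, χ (Additive.ofMul (θ s))) -
        χ (Additive.ofMul q) * ((∑ t ∈ S₂, χ (Additive.ofMul t)) * (∑ t ∈ S₂, χ (Additive.ofMul (θ t)))) = 0) :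
    ∃ b : G → ℚ, b ≠ 0 ∧ (∀ g, b (i c * g) = -b g) ∧ ∀ g : G, ∑ s ∈ S, b (s * g) = 0 := by
  obtain ⟨bC, g₀, h0, hanti, hann⟩ :=
    exists_complex_annihilator_of_det_eq_zero i hi x hx hcov θ hθ q hq hθc S S₁ S₂ hS₁ hS₂ χ hχ hΔ
  obtain ⟨b, hb0, hb, hbann⟩ := exists_rat_annihilator_of_complex S (i c) bC g₀ h0 hanti hann
  exact ⟨b, fun h => hb0 (by rw [h]; rfl), hb, hbann⟩

end Group

end Literature.GroupTheory.TwoSheet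

end
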